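import Summits.MatrixMultiplication.OmegaCensus.STPP222IcosetRankFourCodes

/-!
# ω-census, icoset class at 2-rank four: the H-stage of the kernel engine, II — the CANONICAL representative

HONEST FRAMING (pub-omega census; verbatim): lottery ticket; floor = certified bounds/negative ranges.
Census STRUCTURE bookkeeping (Q7, the involution-coset class), nothing about `ω`.

`rebased` of the raw code list is the insertion sort of the re-based scaled codes (`rebased_raw`); relabelling indices by a
permutation permutes the index lists (`perm_filter_map`), so `rebased` of a relabelled re-based code list is a `rebased` of the raw
codes (`rebased_codeList_eq_raw` — sorted permutations of equal multisets are equal).  Relabelling by the sorting permutation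
`Tuple.sort` (`sortPerm`: base first, then by code) makes the code list `0 ::` a sorted list equal to `rebased` of the raw codes
(`codeList_sortPerm`, `tail_codeList_eq_rebased`).  Hence **`canon_of_min`**: for `(b*, u*)` minimising `rebased n (K+1) (rawCodes β γ) b u`
over `b ≤ K`, `u ∈ U` (`U` closed under products mod `n`), the code list of the data re-based at `b*`, scaled by `u*` and sorted is
`0 :: rebased … b* u*` and `IcosetW.canon n (K+1) U` accepts it.  Consumed by `STPP222IcosetRankFourReduction.lean`.
Seat pub-omega-kernel-l4 (gen 20), 2026-08-27.
-/

namespace Summit.MatrixMultiplication.OmegaCensus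

namespace IcosetW

open IcosetH (getI allN allN_true getI_eq_getD)

/-! ## Raw codes, the sorting relabelling, and the canonical representative -/

section Canon
variable {n : ℕ} [NeZero n] {K : ℕ}

/-- `getI` of `List.ofFn`. -/
theorem getI_ofFn (f : Fin K → ℕ) {t : ℕ} (ht : t < K) : getI (List.ofFn f) t = f ⟨t, ht⟩ := by
  rw [getI_eq_getD, List.getD_eq_getElem?_getD, List.getElem?_ofFn]; simp [ht]

/-- The raw code list of `H`-data. -/
def rawCodes (β γ : Fin K → ZMod n) : List ℕ := List.ofFn fun t => code (β t) (γ t)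

/-- **`rebased` of the raw codes is the insertion sort of the re-based scaled code function.** -/
theorem rebased_raw (β γ : Fin K → ZMod n) {b : ℕ} (hb : b < K) (u : ℕ) :
    rebased n K (rawCodes β γ) b u = insList (cfunN β γ b (u : ZMod n)) b K := by
  rw [rebased_eq_rebRec, rebRec_eq_insList]
  refine insList_congr K fun t ht _ => ?_
  unfold rawCodes
  rw [getI_ofFn _ ht, getI_ofFn _ hb]
  obtain ⟨d1, m1⟩ := code_div_mod (β ⟨t, ht⟩) (γ ⟨t, ht⟩)
  obtain ⟨d2, m2⟩ := code_div_mod (β ⟨b, hb⟩) (γ ⟨b, hb⟩)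
  rw [show Nat.div (code (β ⟨b, hb⟩) (γ ⟨b, hb⟩)) n = code (β ⟨b, hb⟩) (γ ⟨b, hb⟩) / n from rfl,
    show Nat.mod (code (β ⟨b, hb⟩) (γ ⟨b, hb⟩)) n = code (β ⟨b, hb⟩) (γ ⟨b, hb⟩) % n from rfl, d1, m1, d2, m2, transform_eq,
    cfunN_eq β γ hb ht]

/-- A permutation of `Fin K` as a function on `ℕ` (junk `0` beyond `K`). -/
def permN (σ : Equiv.Perm (Fin K)) (t : ℕ) : ℕ := if h : t < K then (σ ⟨t, h⟩).val else 0

omit [NeZero n] in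
/-- `permN` stays below `K`. -/
theorem permN_lt (σ : Equiv.Perm (Fin K)) {t : ℕ} (ht : t < K) : permN σ t < K := by
  unfold permN; rw [dif_pos ht]; exact (σ ⟨t, ht⟩).2

omit [NeZero n] in
/-- **Index permutation lemma.**  Relabelling the indices `≠ b` by `σ` gives, up to order, the indices `≠ σ b`. -/
theorem perm_filter_map (σ : Equiv.Perm (Fin K)) {b : ℕ} (hb : b < K) :
    (((List.range K).filter (· ≠ b)).map (permN σ)).Perm ((List.range K).filter (· ≠ permN σ b)) := by
  apply List.perm_of_nodup_nodup_toFinset_eq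
  · refine List.Nodup.map_on (fun x hx y hy hxy => ?_) ((List.nodup_range).filter _)
    have hx' : x < K := List.mem_range.1 (List.mem_filter.1 hx).1
    have hy' : y < K := List.mem_range.1 (List.mem_filter.1 hy).1
    unfold permN at hxy; rw [dif_pos hx', dif_pos hy'] at hxy
    have := σ.injective (Fin.ext hxy)
    simpa using this
  · exact (List.nodup_range).filter _
  · ext x
    simp only [List.mem_toFinset, List.mem_map, List.mem_filter, List.mem_range, ne_eq, decide_eq_true_eq]
    constructor
    · rintro ⟨t, ⟨ht, htb⟩, rfl⟩
      refine ⟨permN_lt σ ht, fun h => htb ?_⟩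
      unfold permN at h; rw [dif_pos ht, dif_pos hb] at h
      have := σ.injective (Fin.ext h); simpa using this
    · rintro ⟨hx, hxb⟩
      refine ⟨(σ.symm ⟨x, hx⟩).val, ⟨(σ.symm ⟨x, hx⟩).2, fun h => hxb ?_⟩, ?_⟩
      · unfold permN; rw [dif_pos hb]
        have : σ.symm ⟨x, hx⟩ = ⟨b, hb⟩ := Fin.ext h
        have := congrArg σ this; simp at this; rw [← this]
      · unfold permN; rw [dif_pos (σ.symm ⟨x, hx⟩).2]; simp

/-- The code list of the data re-based at `b`, scaled by `u`, relabelled by `σ`. -/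
def codeList (β γ : Fin K → ZMod n) (b : ℕ) (u : ZMod n) (σ : Equiv.Perm (Fin K)) : List ℕ :=
  List.ofFn fun t : Fin K => cfunN β γ b u (permN σ t.val)

/-- `rebased` of a relabelled re-based code list is the insertion sort of the twice-re-based code function relabelled. -/
theorem rebased_codeList (β γ : Fin K → ZMod n) {b₀ : ℕ} (hb₀ : b₀ < K) (u₀ : ZMod n) (σ : Equiv.Perm (Fin K)) {b : ℕ}
    (hb : b < K) (u : ℕ) : rebased n K (codeList β γ b₀ u₀ σ) b u =
      insList (fun t => cfunN β γ (permN σ b) ((u : ZMod n) * u₀) (permN σ t)) b K := by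
  rw [rebased_eq_rebRec, rebRec_eq_insList]
  refine insList_congr K fun t ht _ => ?_
  unfold codeList
  rw [getI_ofFn _ ht, getI_ofFn _ hb]
  exact transform_cfun β γ hb₀ u₀ (permN σ) (fun t ht => permN_lt σ ht) u hb ht

/-- **Equivariance of `rebased`** (sorted permutations of equal multisets are equal). -/
theorem rebased_codeList_eq_raw (β γ : Fin K → ZMod n) {b₀ : ℕ} (hb₀ : b₀ < K) (u₀ : ℕ) (σ : Equiv.Perm (Fin K)) {b : ℕ}
    (hb : b < K) (u : ℕ) :
    rebased n K (codeList β γ b₀ (u₀ : ZMod n) σ) b u = rebased n K (rawCodes β γ) (permN σ b) (u * u₀ % n) := by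
  rw [rebased_codeList β γ hb₀ _ σ hb, rebased_raw β γ (permN_lt σ hb)]
  have hu : ((u * u₀ % n : ℕ) : ZMod n) = (u : ZMod n) * (u₀ : ZMod n) := by
    rw [ZMod.natCast_mod, Nat.cast_mul]
  rw [hu]
  set g := cfunN β γ (permN σ b) ((u : ZMod n) * (u₀ : ZMod n)) with hg
  apply List.Perm.eq_of_sortedLE (insList_sorted _ _ _).sortedLE (insList_sorted _ _ _).sortedLE
  refine (insList_perm _ _ _).trans (List.Perm.trans ?_ (insList_perm _ _ _).symm)
  have e : List.map (fun t => g (permN σ t)) (List.filter (fun x => decide (x ≠ b)) (List.range K)) =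
      List.map g (List.map (permN σ) (List.filter (fun x => decide (x ≠ b)) (List.range K))) := by
    rw [List.map_map]; rfl
  rw [e]
  exact (perm_filter_map σ hb).map g

/-- The sorting key: the base first, the rest by code. -/
def sortKey (β γ : Fin K → ZMod n) (b : Fin K) (u : ZMod n) (t : Fin K) : ℕ :=
  if t = b then 0 else cfunN β γ b.val u t.val + 1

/-- The sorting relabelling. -/
noncomputable def sortPerm (β γ : Fin K → ZMod n) (b : Fin K) (u : ZMod n) : Equiv.Perm (Fin K) :=
  Tuple.sort (sortKey β γ b u)

omit [NeZero n] in
/-- The sorting relabelling puts the base first. -/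
theorem sortPerm_zero (β γ : Fin K → ZMod n) (b : Fin K) (u : ZMod n) (hK : 0 < K) :
    sortPerm β γ b u ⟨0, hK⟩ = b := by
  have hm : Monotone (sortKey β γ b u ∘ (sortPerm β γ b u)) := Tuple.monotone_sort _
  have h := hm (show (⟨0, hK⟩ : Fin K) ≤ (sortPerm β γ b u).symm b from Fin.le_iff_val_le_val.2 (Nat.zero_le _))
  simp only [Function.comp, Equiv.apply_symm_apply] at h
  unfold sortKey at h
  rw [if_pos rfl] at h
  by_contra hne
  rw [if_neg hne] at h
  omega

omit [NeZero n] in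
/-- The code list along the sorting relabelling is `0 ::` a SORTED list. -/
theorem codeList_sortPerm (β γ : Fin (K + 1) → ZMod n) (b : Fin (K + 1)) (u : ZMod n) :
    codeList β γ b.val u (sortPerm β γ b u) =
      0 :: List.ofFn (fun m : Fin K => cfunN β γ b.val u (permN (sortPerm β γ b u) m.succ.val)) ∧
    (List.ofFn (fun m : Fin K => cfunN β γ b.val u (permN (sortPerm β γ b u) m.succ.val))).Pairwise (· ≤ ·) := by
  set σ := sortPerm β γ b u with hσ
  have h0 : σ 0 = b := sortPerm_zero β γ b u (Nat.succ_pos K)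
  have hperm : ∀ t : Fin (K + 1), permN σ t.val = (σ t).val := fun t => by unfold permN; rw [dif_pos t.2]
  constructor
  · unfold codeList; rw [List.ofFn_succ]
    congr 1
    rw [hperm, show ((0 : Fin (K + 1))) = 0 from rfl, h0, cfunN_eq β γ b.2 b.2]; simp [code]
  · rw [List.pairwise_ofFn]
    intro i j hij
    have hmono : Monotone (sortKey β γ b u ∘ σ) := Tuple.monotone_sort _
    have hm := hmono (le_of_lt (Fin.succ_lt_succ_iff.2 hij))
    simp only [Function.comp, sortKey] at hm
    have hi : σ i.succ ≠ b := fun h => Fin.succ_ne_zero i (σ.injective (h.trans h0.symm))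
    have hj : σ j.succ ≠ b := fun h => Fin.succ_ne_zero j (σ.injective (h.trans h0.symm))
    rw [if_neg hi, if_neg hj] at hm
    rw [hperm, hperm]; omega

/-- **The tail of the sorted code list is `rebased` of the raw codes.** -/
theorem tail_codeList_eq_rebased (β γ : Fin (K + 1) → ZMod n) (b : Fin (K + 1)) (u : ℕ) :
    List.ofFn (fun m : Fin K => cfunN β γ b.val (u : ZMod n) (permN (sortPerm β γ b (u : ZMod n)) m.succ.val)) =
      rebased n (K + 1) (rawCodes β γ) b.val u := by
  rw [rebased_raw β γ b.2]
  apply List.Perm.eq_of_sortedLE (codeList_sortPerm β γ b _).2.sortedLE (insList_sorted _ _ _).sortedLE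
  refine List.Perm.trans ?_ (insList_perm _ _ _).symm
  set σ := sortPerm β γ b (u : ZMod n)
  have h0 : σ 0 = b := sortPerm_zero β γ b _ (Nat.succ_pos K)
  -- as maps of index lists
  have e : List.ofFn (fun m : Fin K => cfunN β γ b.val (u : ZMod n) (permN σ m.succ.val)) =
      (List.ofFn fun m : Fin K => permN σ m.succ.val).map (cfunN β γ b.val (u : ZMod n)) := by
    rw [List.map_ofFn]; rfl
  rw [e]
  apply List.Perm.map
  apply List.perm_of_nodup_nodup_toFinset_eq
  · rw [List.nodup_ofFn]
    intro i j hij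
    have hpi : permN σ i.succ.val = (σ i.succ).val := by unfold permN; rw [dif_pos i.succ.2]
    have hpj : permN σ j.succ.val = (σ j.succ).val := by unfold permN; rw [dif_pos j.succ.2]
    simp only [hpi, hpj] at hij
    exact Fin.succ_injective _ (σ.injective (Fin.ext hij))
  · exact (List.nodup_range).filter _
  · ext x
    simp only [List.mem_toFinset, List.mem_ofFn', Set.mem_range, List.mem_filter, List.mem_range, ne_eq,
      decide_eq_true_eq]
    constructor
    · rintro ⟨m, rfl⟩
      have hp : permN σ m.succ.val = (σ m.succ).val := by unfold permN; rw [dif_pos m.succ.2]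
      rw [hp]
      refine ⟨(σ m.succ).2, fun h => Fin.succ_ne_zero m (σ.injective ((Fin.ext h).trans h0.symm))⟩
    · rintro ⟨hx, hxb⟩
      have hne : σ.symm ⟨x, hx⟩ ≠ 0 := fun h => hxb (by
        have := congrArg σ h; rw [Equiv.apply_symm_apply, h0] at this; exact congrArg Fin.val this)
      refine ⟨(σ.symm ⟨x, hx⟩).pred hne, ?_⟩
      have hp : ∀ m : Fin K, permN σ m.succ.val = (σ m.succ).val := fun m => by unfold permN; rw [dif_pos m.succ.2]
      rw [hp, Fin.succ_pred, Equiv.apply_symm_apply]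

/-- `List.rec`-conjunction over a list. -/
theorem listRec_and_true {f : ℕ → Bool} : ∀ (U : List ℕ), (∀ u ∈ U, f u = true) →
    (@List.rec ℕ (fun _ => Bool) true (fun u _ ih => ih && f u) U) = true := by
  intro U
  induction U with
  | nil => intro _; rfl
  | cons u U ih =>
    intro h
    show (_ && f u) = true
    rw [Bool.and_eq_true]
    exact ⟨ih fun v hv => h v (List.mem_cons_of_mem _ hv), h u List.mem_cons_self⟩

/-- The candidate pairs `(b, u)`, `b < K`, `u ∈ U`. -/
def cands (K : ℕ) (U : List ℕ) : List (ℕ × ℕ) := (List.range K).flatMap fun b => U.map fun u => (b, u)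

omit [NeZero n] in
/-- Membership in `cands`. -/
theorem mem_cands {K : ℕ} {U : List ℕ} {b u : ℕ} : (b, u) ∈ cands K U ↔ b < K ∧ u ∈ U := by
  unfold cands; simp [List.mem_flatMap, List.mem_map, List.mem_range]

/-- **THE CANONICAL REPRESENTATIVE.**  Let `(b*, u*)` minimise `rebased n (K+1) (rawCodes β γ) b u` over `b ≤ K`, `u ∈ U`
(`argmin2`), `U` closed under products mod `n`.  Then the code list of the data re-based at `b*`, scaled by `u*` and relabelled by
the sorting permutation is `0 :: rebased … b* u*`, and it is CANONICAL for the engine. -/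
theorem canon_of_min (β γ : Fin (K + 1) → ZMod n) (U : List ℕ) (hU : ∀ u ∈ U, ∀ u' ∈ U, u * u' % n ∈ U)
    {b u : ℕ} (hb : b < K + 1) (hu : u ∈ U)
    (hmin : ∀ p ∈ cands (K + 1) U, lexLt (rebased n (K + 1) (rawCodes β γ) p.1 p.2) (rebased n (K + 1) (rawCodes β γ) b u) = false) :
    codeList β γ b (u : ZMod n) (sortPerm β γ ⟨b, hb⟩ (u : ZMod n)) = 0 :: rebased n (K + 1) (rawCodes β γ) b u ∧
    canon n (K + 1) U (codeList β γ b (u : ZMod n) (sortPerm β γ ⟨b, hb⟩ (u : ZMod n))) = true := by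
  have hD := (codeList_sortPerm β γ ⟨b, hb⟩ (u : ZMod n)).1
  rw [tail_codeList_eq_rebased β γ ⟨b, hb⟩ u] at hD
  refine ⟨hD, ?_⟩
  unfold canon
  rw [frcL_eq, hD]
  show allN (K + 1) (fun b' => @List.rec ℕ (fun _ => Bool) true (fun u' _ ih => ih &&
    !(lexLt (rebased n (K + 1) (0 :: rebased n (K + 1) (rawCodes β γ) b u) b' u') (rebased n (K + 1) (rawCodes β γ) b u))) U) = true
  refine IcosetH.allN_of_forall fun b' hb' => listRec_and_true U fun u' hu' => ?_
  rw [Bool.not_eq_true', ← hD, rebased_codeList_eq_raw β γ hb u _ hb' u']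
  exact hmin _ (mem_cands.2 ⟨permN_lt _ hb', hU u' hu' u hu⟩)

end Canon

end IcosetW

end Summit.MatrixMultiplication.OmegaCensus
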